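import Summits.BirchSwinnertonDyer.Rank1Residual.X11b.AnticyclotomicSelmerStructure
import Summits.BirchSwinnertonDyer.Rank1Residual.X11b.PrimaryInclusionLevels
import HarnessLib

/-!
# X11b, route R1 — the PROPAGATED finite-level Castella structure on `E[p^k]` and
# `Sel_𝔭^Σ(K, E[p^∞]) ≅ H¹_{𝓛^{(k)}}(K, E[p^k])` for `k ≫ 0` (the `W`-side of the limit layer)

HONEST FRAMING (cell `b2b-bsdres`, run/shared/lean/b2b/bsd-rank1-residual/, verbatim in every
file): the goal of the cell is to DELETE the COMBINATION-SHAPED residual classes of the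
Birch–Swinnerton-Dyer formula for ALL analytic-rank `≤ 1` elliptic curves over `ℚ` — "full BSD
formula for every rank `≤ 1` curve in class `C`" assembled STRICTLY from published theorems — so
that the rank-`≤ 1` remainder becomes exactly the CONSTRUCTION-SHAPED classes, which are TYPED
(missing-input `Prop`s), NOT attempted. This is not "finishing BSD". Sub-cell
`b2b-bsdres-multr1-p1` (X11b, route R1 = Castella 2018 Thm. A re-proved along the author's
erratum); a RESEARCH ROUTE; no claim beyond the stated class; X11b stays CONSTRUCTION-SHAPED;
nothing here changes a label; no named fact is minted (two definitions with bodies — the pulled-back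
Selmer structure along an intertwining map, and its instance for `E[p^k] ↪ E[p^∞]` — and theorems;
no `sorry`).

## What is here

Howard 2004, Def. 2.1.1 (= Mazur–Rubin 2004, Example 2.1.8, "propagation"): a local condition
`𝓛_v ≤ H¹(K_v, B)` induces on a submodule (here along an injective intertwining map `i : A ↪ B`)
the local condition `i_*⁻¹(𝓛_v) ≤ H¹(K_v, A)`.  For route R1: the Poitou–Tate fact of the tree is
stated for finite modules; Castella's Selmer group over `K` lives on `W = E[p^∞]`
(`AcSelmer.acStructure (primaryGaloisModule W p)`, `AnticyclotomicSelmerStructure`); the propagated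
structure on `E[p^k]` along `primaryInclusion W p k` is the finite-level object to which
`poitouTate_selmerStructure_duality` will be applied.

* `Levels.comapStructure f 𝓛'` — the Selmer structure `v ↦ (f|_{Γ_{K_v}})_*⁻¹(𝓛'_v)` on `ρ` pulled
  back from `𝓛'` on `ρ'` along `f : ρ →ⁱL ρ'`; **`Levels.selmerGroup_comapStructure`:
  `H¹_{f^*𝓛'}(K, A) = H¹(f)⁻¹(H¹_{𝓛'}(K, B))`** (naturality `loc_v ∘ H¹(f) = H¹(f_v) ∘ loc_v`,
  the tree's `galoisCohomology.res_map_one`).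
* `AcSelmer.acLevelStructure W p k 𝔭 Σ` — Castella's structure PROPAGATED to `E[p^k]`: at the places
  where `𝓛^{ac,Σ} = 0` (infinite places, `𝔭`, finite `v ∉ Σ` away from `p`) the condition
  `ker (H¹(K_v, E[p^k]) → H¹(K_v, E[p^∞]))` = the connecting classes of `E[p^∞]^{Γ_{K_v}}`
  (`PrimaryInclusionLevels.map_primaryInclusion_restrictField_eq_zero_iff`); `⊤` elsewhere
  (`acLevelStructure_eq_top_of`, `acLevelStructure_eq_ker_of`).
* **`AcSelmer.selmerGroup_acLevelStructure`**: `H¹_{𝓛^{(k)}}(K, E[p^k]) = H¹(ι_k)⁻¹(H¹_{𝓛^{ac,Σ}}(K, E[p^∞]))`;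
  **`AcSelmer.map_mem_selmerGroup_acStructure_iff`**; with `E[p^∞]^{Γ_K} = 0`:
  `H¹(ι_k)` is injective on it (`injOn`), and its image is `H¹_{𝓛^{ac,Σ}}(K, E[p^∞])[p^k]`
  (`exists_map_eq_of_mem_of_nsmul_eq_zero`); hence **`AcSelmer.natCard_selmerGroup_acLevelStructure_eq`:
  if `p^k` kills `H¹_{𝓛^{ac,Σ}}(K, E[p^∞])` then `#H¹_{𝓛^{(k)}}(K, E[p^k]) = #H¹_{𝓛^{ac,Σ}}(K, E[p^∞])`**,
  and for route R1 **`AcSelmer.natCard_selmerAcBase_eq_natCard_level`: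
  `#Sel_𝔭^Σ(K, E[p^∞]) = #H¹_{𝓛^{(k)}}(K, E[p^k])`** — the left side of (P6) and the source of (P9)
  are the Selmer group of a FINITE-LEVEL Selmer structure, for every `k` with
  `p^k · Sel_𝔭^Σ(K, E[p^∞]) = 0`.

References: [Howard2004HeegnerKolyvagin] Def. 2.1.1 (arXiv:1202.6340 p. 5); [MazurRubin2004]
Def. 2.1.1, Ex. 2.1.8; [Castella2018] Def. 2.2; [JetchevSkinnerWan2017] §3.1–§3.3;
[GreenbergLNM1716] §2, §5 proof of Prop. 5.8.
-/

noncomputable section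

open scoped Classical

open CategoryTheory NumberField IsDedekindDomain Field
open Literature.NumberTheory.EllipticCurves Literature.NumberTheory.EllipticCurves.GreenbergSelmer
open Literature.NumberTheory.GaloisRepresentations
open Literature.NumberTheory.GaloisRepresentations.DiscreteGaloisModule (SelmerStructure)
open scoped ContRepresentation

universe u

/-! ## §1. Pulling back a Selmer structure along an intertwining map (propagation) -/

namespace Summit.BirchSwinnertonDyer.Rank1Residual.X11b.Levels

section Comap

variable {K : Type u} [Field K] [NumberField K] {A B : Type u} [AddCommGroup A]
  [TopologicalSpace A] [DiscreteTopology A] [AddCommGroup B] [TopologicalSpace B]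
  [DiscreteTopology B] {ρ : DiscreteGaloisModule K A} {ρ' : DiscreteGaloisModule K B}

/-- **Propagation of local conditions along an intertwining map** (Howard Def. 2.1.1 / Mazur–Rubin
Ex. 2.1.8 for a submodule `i : A ↪ B`): the Selmer structure on `ρ` whose local condition at `v` is
the preimage of `𝓛'_v` under `H¹(K_v, A) → H¹(K_v, B)` (the map of the restricted intertwining map
`f|_{Γ_{K_v}}`). [cite: Howard2004HeegnerKolyvagin, Def. 2.1.1 (arXiv:1202.6340 p. 5)] -/
def comapStructure (f : ρ.toContRepresentation →ⁱL ρ'.toContRepresentation)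
    (𝓛' : SelmerStructure ρ') : SelmerStructure ρ := fun v ↦
  (𝓛' v).comap (galoisCohomology.map (f.restrictField (Place.Completion v)) 1)

/-- Membership in a propagated local condition. [cite: Howard2004HeegnerKolyvagin, Def. 2.1.1 (arXiv:1202.6340 p. 5)] -/
theorem mem_comapStructure_iff (f : ρ.toContRepresentation →ⁱL ρ'.toContRepresentation)
    (𝓛' : SelmerStructure ρ') (v : Place K) (x : galoisCohomology (ρ.toLocal v) 1) :
    x ∈ comapStructure f 𝓛' v ↔
      galoisCohomology.map (f.restrictField (Place.Completion v)) 1 x ∈ 𝓛' v :=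
  Iff.rfl

/-- Naturality of localisation: `loc_v (H¹(f) c) = H¹(f|_{Γ_{K_v}}) (loc_v c)` (the tree's
`galoisCohomology.res_map_one` read at `Place.Completion v`). [folklore] -/
theorem localization_map_one (f : ρ.toContRepresentation →ⁱL ρ'.toContRepresentation)
    (v : Place K) (c : galoisCohomology ρ 1) :
    galoisCohomology.localization ρ' v 1 (galoisCohomology.map f 1 c) =
      galoisCohomology.map (f.restrictField (Place.Completion v)) 1
        (galoisCohomology.localization ρ v 1 c) :=
  galoisCohomology.res_map_one (Place.Completion v) f c

/-- **`H¹_{f^*𝓛'}(K, A) = H¹(f)⁻¹ H¹_{𝓛'}(K, B)`**: the Selmer group of the propagated structure is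
the preimage of the Selmer group (place by place, by naturality of localisation).
[cite: Howard2004HeegnerKolyvagin, Def. 2.1.1 (arXiv:1202.6340 p. 5)] [cite: MazurRubin2004, Def. 2.1.1] -/
theorem selmerGroup_comapStructure (f : ρ.toContRepresentation →ⁱL ρ'.toContRepresentation)
    (𝓛' : SelmerStructure ρ') :
    (comapStructure f 𝓛').selmerGroup = (𝓛'.selmerGroup).comap (galoisCohomology.map f 1) := by
  ext c
  rw [AddSubgroup.mem_comap, SelmerStructure.mem_selmerGroup_iff,
    SelmerStructure.mem_selmerGroup_iff]
  refine forall_congr' fun v ↦ ?_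
  rw [mem_comapStructure_iff, localization_map_one]
  exact Iff.rfl

/-- Membership form of `selmerGroup_comapStructure`. [cite: Howard2004HeegnerKolyvagin, Def. 2.1.1 (arXiv:1202.6340 p. 5)] -/
theorem mem_selmerGroup_comapStructure_iff (f : ρ.toContRepresentation →ⁱL ρ'.toContRepresentation)
    (𝓛' : SelmerStructure ρ') (c : galoisCohomology ρ 1) :
    c ∈ (comapStructure f 𝓛').selmerGroup ↔ galoisCohomology.map f 1 c ∈ 𝓛'.selmerGroup := by
  rw [selmerGroup_comapStructure, AddSubgroup.mem_comap]

/-- Propagating `⊤` gives `⊤`. [folklore] -/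
theorem comapStructure_apply_eq_top_of (f : ρ.toContRepresentation →ⁱL ρ'.toContRepresentation)
    (𝓛' : SelmerStructure ρ') {v : Place K} (hv : 𝓛' v = ⊤) : comapStructure f 𝓛' v = ⊤ := by
  rw [comapStructure, hv]
  exact AddSubgroup.comap_top _

/-- Propagating `0` gives the kernel of `H¹(K_v, A) → H¹(K_v, B)`. [folklore] -/
theorem comapStructure_apply_eq_ker_of (f : ρ.toContRepresentation →ⁱL ρ'.toContRepresentation)
    (𝓛' : SelmerStructure ρ') {v : Place K} (hv : 𝓛' v = ⊥) :
    comapStructure f 𝓛' v = (galoisCohomology.map (f.restrictField (Place.Completion v)) 1).ker := by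
  rw [comapStructure, hv]
  rfl

/-- **`H¹(f)` restricted to `H¹_{f^*𝓛'}(K, A)` is injective when `H¹(f)` is** (e.g. no invariant
points, `Levels.map_one_injective_of_forall_fixed_eq_zero`). [folklore] -/
theorem injOn_map_selmerGroup_comapStructure
    (f : ρ.toContRepresentation →ⁱL ρ'.toContRepresentation) (𝓛' : SelmerStructure ρ')
    (hinj : Function.Injective (galoisCohomology.map f 1)) :
    Set.InjOn (galoisCohomology.map f 1) ((comapStructure f 𝓛').selmerGroup : Set _) :=
  hinj.injOn

/-- **The image of `H¹_{f^*𝓛'}(K, A)` under `H¹(f)` is `H¹_{𝓛'}(K, B) ∩ im H¹(f)`.** [folklore] -/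
theorem map_selmerGroup_comapStructure (f : ρ.toContRepresentation →ⁱL ρ'.toContRepresentation)
    (𝓛' : SelmerStructure ρ') :
    ((comapStructure f 𝓛').selmerGroup).map (galoisCohomology.map f 1) =
      𝓛'.selmerGroup ⊓ (galoisCohomology.map f 1).range := by
  rw [selmerGroup_comapStructure, AddSubgroup.map_comap_eq, inf_comm]

end Comap

end Summit.BirchSwinnertonDyer.Rank1Residual.X11b.Levels

/-! ## §2. Castella's structure propagated to `E[p^k]` -/

namespace Summit.BirchSwinnertonDyer.Rank1Residual.X11b.AcSelmer

open Summit.BirchSwinnertonDyer.Rank1Residual.X11b.LocBridge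
open Summit.BirchSwinnertonDyer.Rank1Residual.X11b.Levels

variable {K : Type u} [Field K] [NumberField K] (W : WeierstrassCurve K) (p k : ℕ)
  (𝔭 : HeightOneSpectrum (𝓞 K)) (S : Set (HeightOneSpectrum (𝓞 K)))

/-- **Castella's Selmer structure `𝓛^{(k)} = 𝓛^{ac,Σ,(k)}_𝔭` on the finite module `E[p^k]`**: the
structure `acStructure (primaryGaloisModule W p) p 𝔭 Σ` on `E[p^∞]` PROPAGATED along
`E[p^k] ↪ E[p^∞]` (Howard Def. 2.1.1): `ker (H¹(K_v, E[p^k]) → H¹(K_v, E[p^∞]))` at the infinite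
places, at `𝔭` and at the finite `v ∉ Σ` away from `p`; everything at the other places above `p`
and on `Σ`. A definition; nothing asserted. [cite: Castella2018, Def. 2.2 (arXiv:1704.06608 p. 5)]
[cite: Howard2004HeegnerKolyvagin, Def. 2.1.1 (arXiv:1202.6340 p. 5)] -/
def acLevelStructure : SelmerStructure (W.torsionGaloisModule ((p ^ k : ℕ) : ℤ)) :=
  comapStructure (primaryInclusion W p k) (acStructure (primaryGaloisModule W p) p 𝔭 S)

/-- `𝓛^{(k)}` is `⊤` wherever `𝓛^{ac,Σ}` is (places above `p` other than `𝔭`; places of `Σ`).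
[cite: Castella2018, Def. 2.2 (arXiv:1704.06608 p. 5)] -/
theorem acLevelStructure_eq_top_of {v : Place K}
    (hv : acStructure (primaryGaloisModule W p) p 𝔭 S v = ⊤) : acLevelStructure W p k 𝔭 S v = ⊤ :=
  comapStructure_apply_eq_top_of _ _ hv

/-- `𝓛^{(k)}` is the kernel of `H¹(K_v, E[p^k]) → H¹(K_v, E[p^∞])` wherever `𝓛^{ac,Σ} = 0`
(infinite places, `𝔭`, finite `v ∉ Σ` away from `p`) — by
`PrimaryInclusionLevels.map_primaryInclusion_restrictField_eq_zero_iff` these are the connecting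
classes of the points `Q ∈ E[p^∞]` with `p^k • Q ∈ E[p^∞]^{Γ_{K_v}}`.
[cite: Howard2004HeegnerKolyvagin, Def. 2.1.1 (arXiv:1202.6340 p. 5)] -/
theorem acLevelStructure_eq_ker_of {v : Place K}
    (hv : acStructure (primaryGaloisModule W p) p 𝔭 S v = ⊥) :
    acLevelStructure W p k 𝔭 S v =
      (galoisCohomology.map ((primaryInclusion W p k).restrictField (Place.Completion v)) 1).ker :=
  comapStructure_apply_eq_ker_of _ _ hv

/-- **`H¹_{𝓛^{(k)}}(K, E[p^k]) = H¹(ι_k)⁻¹(H¹_{𝓛^{ac,Σ}}(K, E[p^∞]))`.**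
[cite: Howard2004HeegnerKolyvagin, Def. 2.1.1 (arXiv:1202.6340 p. 5)] -/
theorem selmerGroup_acLevelStructure :
    (acLevelStructure W p k 𝔭 S).selmerGroup =
      ((acStructure (primaryGaloisModule W p) p 𝔭 S).selmerGroup).comap
        (galoisCohomology.map (primaryInclusion W p k) 1) :=
  selmerGroup_comapStructure _ _

/-- Membership form: `c ∈ H¹_{𝓛^{(k)}}(K, E[p^k]) ↔ ι_k c ∈ H¹_{𝓛^{ac,Σ}}(K, E[p^∞])`.
[cite: Howard2004HeegnerKolyvagin, Def. 2.1.1 (arXiv:1202.6340 p. 5)] -/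
theorem mem_selmerGroup_acLevelStructure_iff
    (c : galoisCohomology (W.torsionGaloisModule ((p ^ k : ℕ) : ℤ)) 1) :
    c ∈ (acLevelStructure W p k 𝔭 S).selmerGroup ↔
      galoisCohomology.map (primaryInclusion W p k) 1 c ∈
        (acStructure (primaryGaloisModule W p) p 𝔭 S).selmerGroup :=
  mem_selmerGroup_comapStructure_iff _ _ c

/-- … and then (route R1's object) `topEquivH1 (ι_k c) ∈ Sel_𝔭^Σ(K, E[p^∞]) = selmerAcBase`.
[cite: Castella2018, Def. 2.2 (arXiv:1704.06608 p. 5)] -/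
theorem mem_selmerGroup_acLevelStructure_iff_selmerAcBase [Fact p.Prime]
    (c : galoisCohomology (W.torsionGaloisModule ((p ^ k : ℕ) : ℤ)) 1) :
    c ∈ (acLevelStructure W p k 𝔭 S).selmerGroup ↔
      topEquivH1 (isOpen_stabilizer_geomPrimaryTorsion W p)
          (galoisCohomology.map (primaryInclusion W p k) 1 c) ∈ selmerAcBase W p 𝔭 S := by
  rw [mem_selmerGroup_acLevelStructure_iff, topEquivH1_mem_selmerAcBase_iff]

/-- **The image of `H¹_{𝓛^{(k)}}(K, E[p^k])` in `H¹(K, E[p^∞])` is `H¹_{𝓛^{ac,Σ}}(K, E[p^∞])[p^k]`**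
(for `W` elliptic, granted the divisibility of `E(K̄)`): every class of Castella's Selmer group over
`K` killed by `p^k` comes from level `k`. [cite: GreenbergLNM1716, §5 proof of Prop. 5.8] -/
theorem exists_map_eq_of_mem_of_nsmul_eq_zero [Fact p.Prime] (hdiv : W.zsmul_geomPoints_surjective)
    [W.IsElliptic] {x : galoisCohomology (primaryGaloisModule W p) 1}
    (hx : x ∈ (acStructure (primaryGaloisModule W p) p 𝔭 S).selmerGroup) (hpx : p ^ k • x = 0) :
    ∃ c ∈ (acLevelStructure W p k 𝔭 S).selmerGroup,
      galoisCohomology.map (primaryInclusion W p k) 1 c = x := by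
  obtain ⟨c, rfl⟩ := (mem_range_map_primaryInclusion_iff W p k hdiv x).mpr hpx
  exact ⟨c, (mem_selmerGroup_acLevelStructure_iff W p k 𝔭 S c).mpr hx, rfl⟩

/-- **`H¹(ι_k)` is injective on `H¹_{𝓛^{(k)}}(K, E[p^k])` when `E[p^∞]^{Γ_K} = 0`** (e.g.
`E(K)[p] = 0`; JSW17's (irr_K)). [cite: GreenbergLNM1716, §2 p. 63] -/
theorem map_primaryInclusion_injOn
    (hΓ : ∀ Q : W.geomPrimaryTorsion p,
      (∀ σ : absoluteGaloisGroup K, primaryGaloisModule W p σ Q = Q) → Q = 0) :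
    Set.InjOn (galoisCohomology.map (primaryInclusion W p k) 1)
      ((acLevelStructure W p k 𝔭 S).selmerGroup : Set _) :=
  (map_primaryInclusion_injective W p k hΓ).injOn

/-- **`#H¹_{𝓛^{(k)}}(K, E[p^k]) = #H¹_{𝓛^{ac,Σ}}(K, E[p^∞])` as soon as `p^k` kills the latter**
(and `E[p^∞]^{Γ_K} = 0`, `W` elliptic): `H¹(ι_k)` restricts to a bijection.  For a FINITE
`H¹_{𝓛^{ac,Σ}}(K, E[p^∞])` such `k` exist (its exponent). [cite: GreenbergLNM1716, §5 proof of Prop. 5.8]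
[cite: JetchevSkinnerWan2017, §3.1–3.3 (arXiv:1512.06894 pp. 10–13)] -/
theorem natCard_selmerGroup_acLevelStructure_eq [Fact p.Prime] (hdiv : W.zsmul_geomPoints_surjective)
    [W.IsElliptic]
    (hΓ : ∀ Q : W.geomPrimaryTorsion p,
      (∀ σ : absoluteGaloisGroup K, primaryGaloisModule W p σ Q = Q) → Q = 0)
    (hk : ∀ x ∈ (acStructure (primaryGaloisModule W p) p 𝔭 S).selmerGroup, p ^ k • x = 0) :
    Nat.card ((acLevelStructure W p k 𝔭 S).selmerGroup) =
      Nat.card ((acStructure (primaryGaloisModule W p) p 𝔭 S).selmerGroup) := by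
  refine Nat.card_congr (Equiv.ofBijective
    (fun c ↦ ⟨galoisCohomology.map (primaryInclusion W p k) 1 c,
      (mem_selmerGroup_acLevelStructure_iff W p k 𝔭 S c.1).mp c.2⟩) ⟨?_, ?_⟩)
  · rintro ⟨c, hc⟩ ⟨c', hc'⟩ h
    exact Subtype.ext (map_primaryInclusion_injective W p k hΓ (congrArg Subtype.val h))
  · rintro ⟨x, hx⟩
    obtain ⟨c, hc, rfl⟩ := exists_map_eq_of_mem_of_nsmul_eq_zero W p k 𝔭 S hdiv hx (hk x hx)
    exact ⟨⟨c, hc⟩, rfl⟩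

/-- **Route R1: `#Sel_𝔭^Σ(K, E[p^∞]) = #H¹_{𝓛^{(k)}}(K, E[p^k])` for every `k` with
`p^k · Sel_𝔭^Σ(K, E[p^∞]) = 0`** (`E[p^∞]^{Γ_K} = 0`, `W` elliptic, `E(K̄)` divisible): Castella's
Selmer group over `K` — the left side of (P6) `BaseSelmerCountAt` and the source of (P9)
`LocSurjAt` — has the cardinality of the Selmer group of the FINITE-LEVEL Selmer structure
`acLevelStructure`, an object of the Poitou–Tate vocabulary on the finite module `E[p^k]`.
[cite: Castella2018, Def. 2.2 and Thm. 2.3 (arXiv:1704.06608 p. 5)]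
[cite: JetchevSkinnerWan2017, Prop. 3.2.1, §3.3.1 (arXiv:1512.06894 pp. 10–11) (shape only)] -/
theorem natCard_selmerAcBase_eq_natCard_level [Fact p.Prime] (hdiv : W.zsmul_geomPoints_surjective)
    [W.IsElliptic]
    (hΓ : ∀ Q : W.geomPrimaryTorsion p,
      (∀ σ : absoluteGaloisGroup K, primaryGaloisModule W p σ Q = Q) → Q = 0)
    (hk : ∀ x ∈ (acStructure (primaryGaloisModule W p) p 𝔭 S).selmerGroup, p ^ k • x = 0) :
    Nat.card (selmerAcBase W p 𝔭 S) = Nat.card ((acLevelStructure W p k 𝔭 S).selmerGroup) := by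
  rw [natCard_selmerAcBase_eq_natCard_selmerGroup,
    natCard_selmerGroup_acLevelStructure_eq W p k 𝔭 S hdiv hΓ hk]

/-- The exponent hypothesis from finiteness: if Castella's Selmer group over `K` is finite, then
`p^k` kills `H¹_{𝓛^{ac,Σ}}(K, E[p^∞])` for every `k` with `#Sel ∣ p^k` — e.g. `k = log_p #Sel` when
`#Sel` is a power of `p` (it is: `H¹(K, E[p^∞])` is `p`-primary). Stated with the divisibility as
hypothesis. [folklore] -/
theorem pow_nsmul_eq_zero_of_natCard_dvd
    (hk : Nat.card ((acStructure (primaryGaloisModule W p) p 𝔭 S).selmerGroup) ∣ p ^ k)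
    (x : galoisCohomology (primaryGaloisModule W p) 1)
    (hx : x ∈ (acStructure (primaryGaloisModule W p) p 𝔭 S).selmerGroup) : p ^ k • x = 0 := by
  obtain ⟨m, hm⟩ := hk
  have h1 : Nat.card ((acStructure (primaryGaloisModule W p) p 𝔭 S).selmerGroup) •
      (⟨x, hx⟩ : (acStructure (primaryGaloisModule W p) p 𝔭 S).selmerGroup) = 0 :=
    card_nsmul_eq_zero'
  have h2 : p ^ k • (⟨x, hx⟩ : (acStructure (primaryGaloisModule W p) p 𝔭 S).selmerGroup) = 0 := by
    rw [hm, mul_comm, mul_smul, h1, smul_zero]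
  exact congrArg Subtype.val h2

end Summit.BirchSwinnertonDyer.Rank1Residual.X11b.AcSelmer

end
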